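import Summits.QuantumFields.BalabanUV.Gaps.BlockPairCriticalOffBlock

/-!
# `BalabanUV.Gaps.BlockPairCriticalSameBlockLog` — cell `pub-balaban-gaps` (YM blitz Y1), track G1, seat g1-p1 (GEN 6), row (D1): **THE SAME-BLOCK
# PAIR COUNT AT THE CRITICAL RIESZ EXPONENT `p = d` IS GENUINELY LOGARITHMIC** — for every `d ≥ 1`, every block side `n+1` and every block `y`,
# `d·(n+1)^d·(log(n+1) − log 2) ≤ Σ_{x∈B n y} Σ_{x′∈B n y} nrm(x−x′)^{−d} ≤ (n+1)^d·(1 + 2d·3^{d−1}·(1 + log n))`,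
# hence NO constant `C` gives `Σ_{x,x′∈B n y} nrm(x−x′)^{−d} ≤ C·(n+1)^d` for all `n` (`not_exists_sameBlock_crit_le_linear`).  With this lineage's
# `BlockPairCriticalOffBlock.sum_B_sum_B_inv_nrm_crit_le_of_ne` (DISTINCT blocks: `≤ (1 + 6d·3^{d−1})·(n+1)^d`, no log) the logarithm of the
# critical block-pair count (b2b leaf-04 g25 `D1BFx/BlockPairRieszCount.sum_box_box_inv_nrm_four_le_d4`, and the `n^D·(c₀ + log n)` of the (d1-b)
# word-family letter `D1BFx/ProfileWordFamiliesCrit.decay510_biBubble_of_profiles_crit`) is PINNED to the same-block class and is TWO-SIDED there.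

HONEST FRAMING (cell rule, page 1 of everything).  WHAT THIS IS: elementary counting on `ℤ^d` — (i) at every site `x` of a block an ORTHANT BOX of
side `⌊n∕2⌋` fits inside the block (local coordinates `loc n x ± w`, `w ∈ [0,⌊n∕2⌋]^d`, the sign chosen towards the roomier side; injective in `w`,
and `nrm(x − ·) = max(1,‖w‖∞)` on it), so the row `Σ_{x′∈B n y} nrm(x−x′)^{−d}` dominates `Σ_{w ∈ [0,⌊n∕2⌋]^d} max(1,‖w‖∞)^{−d}`; (ii) a layer-cake
rearrangement of the latter against the cubes `[0,r]^d` (`(r+1)^d` points) and Bernoulli's inequality `((r+1)∕r)^d − 1 ≥ d∕r` give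
`≥ d·Σ_{r=1}^{⌊n∕2⌋} 1∕r`; (iii) Mathlib's `log_add_one_le_harmonic` and `⌊n∕2⌋ + 1 ≥ (n+1)∕2`.  The upper companion is b2b leaf-04's critical window
`D1BFx.LatticeHLSRadial.sum_inv_nrm_pow_crit_le` BY NAME.  WHAT THIS IS NOT: nothing of Bałaban's is asserted, used or discharged; no lower bound on any
leg, table or word of the road «BF-x» is claimed (a word is bounded BELOW by its profile only where a consumer proves so — none does here); no (1.22)
row; it says nothing about cancellations ACROSS words (the paired tadpole + bubble Ward booking of an2 g45 R-D1-g45-4, the charge-free bookings of the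
OWNER d1-p2 g23 and leaf-01 g30) nor about ORIENTATION (leaf-04 g26 N-1 ∕ GHOST-N8-SPEC v0.2 (O6): every ghost `P`-word is sub-critical in its own
grouping; only the complete `(G;G)` main word is critical) — which is exactly where the owners have placed the work.  Census value only (cell
`pub-balaban-gaps` row (D1), `g1/RESIDUE.md` part (D1) rows 41 ∕ 45 ∕ R-1): the kernel certificate that the `log` of the critical count is structural —
an absolute-value profile letter cannot deliver an m-uniform bound in the `n^d` currency for a same-block CRITICAL pair mass (the main word's); it is
silent on sub-critical groupings.  [B12] Thm 2 stays UNPROVED in print; binder (D1) is NOT discharged; 0∕4 row-D1 binders; (K) NOT closed; NOT `BetaPertH`,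
NOT the continuum limit on ℝ⁴, NOT a mass gap, NOT Clay.
HONEST DEPENDENCY (cell records, verbatim): «continuum YM on T⁴ ⇐ BetaPertH ∧ nine spine estimates (0/9 proved); BetaPertH ⇐ (D1) ∧ (D4) ∧ CAP+tail;
G-an2-4 gates asym, D1 and NE2/3/4.»  ABSOLUTE RULE (cell charter, verbatim): «No internally-minted statement may enter as a cited fact. Every
hypothesis is either kernel-proved in this package or a verbatim quotation of a PUBLISHED theorem with page reference.»  No `def`, no `def … : Prop`,
nothing cited as mathematics, 0 sorry, axioms ⊆ the standard trio.

CONTENT ([folklore]; `X d = Fin d → ℤ`, blocks `B n y` of side `n+1` with `loc`∕`chart` from `B6QGQLower276`, `nrm = max(1,‖·‖∞)` from `PoissonInterior`):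
* §1 `log_succ_le_sum_Icc_inv` (`log(m+1) ≤ Σ_{r=1}^{m} 1∕r`), `bernoulli_div` (`d∕r ≤ (r+1)^d·(1∕r^d − 1∕(r+1)^d)`), `sum_Ico_telescope_le` ∕
  `sum_Icc_telescope_le`, the cube `[0,m]^d ⊆ ℕ^d` (`card_W`, `filter_W_sup_le`), the layer cake **`sum_W_inv_pow_ge`**:
  `d·Σ_{r=1}^{m} 1∕r ≤ Σ_{w∈[0,m]^d} max(1,‖w‖∞)^{−d}`.
* §2 the orthant box (`sgn_ne_zero`, `sgn_natAbs`, `loc_shift_mem`, `orthant_toNat_lt`, `chart_mem_B`, `sub_chart_apply`) and the row bound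
  **`sum_B_inv_nrm_crit_ge_row`**: `x ∈ B n y ⟹ d·log(⌊n∕2⌋+1) ≤ Σ_{x′∈B n y} nrm(x−x′)^{−d}`.
* §3 **`sum_B_sum_B_inv_nrm_crit_ge`**: `d·(n+1)^d·(log(n+1) − log 2) ≤ Σ_{x∈B n y}Σ_{x′∈B n y} nrm(x−x′)^{−d}`; the upper companion
  `sum_B_sum_B_inv_nrm_crit_le_same` (`≤ (n+1)^d·(1 + 2d·3^{d−1}·(1 + log n))`, leaf-04's window BY NAME); **`not_exists_sameBlock_crit_le_linear`**.
* §4 `d = 4` readings: `four_sameBlock_crit_ge` (`4·(n+1)⁴·(log(n+1) − log 2) ≤ …`), in the road's `B (n−1) y`∕`[NeZero n]` spelling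
  `four_sameBlock_crit_ge_pred` (`4·n⁴·(log n − log 2) ≤ …`), and `not_exists_sameBlock_crit_le_linear_four`.
Unit `pub-balaban-gaps-g1-p1` (GEN 6), cell pub-balaban-gaps track G1 (binder (D1)); bus INTENT I-gapsg1p1-14.
-/

namespace Summit.QuantumFields.BalabanUV.Gaps.BlockPairCriticalSameBlockLog

open Finset Real
open Literature.MathematicalPhysics.QuantumFieldTheory.Balaban1983to89
open Literature.MathematicalPhysics.QuantumFieldTheory.Balaban1983to89.Beta
open B6QGQLower276 (X blk loc side B mem_B side_mul_blk_add_loc loc_nonneg loc_le chart chart_inj)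
open B6QGQDecay237 (card_B)
open PoissonInterior (supNorm nrm nrm_pos one_le_nrm)
open Summit.QuantumFields.BalabanUV.Beta.D1BFx.LatticeHLSRadial (sum_inv_nrm_pow_crit_le)
open Summit.QuantumFields.BalabanUV.Gaps.BlockPairProfileMass (supNorm_sub_le_of_mem_B nrm_sub_comm cast_pred_add_one)

noncomputable section

variable {d : ℕ}

/-! ## §1 One-dimensional tools and the layer cake on the cube `[0,m]^d ⊆ ℕ^d` -/

section LayerCake

/-- [folklore] `log(m+1) ≤ Σ_{r=1}^{m} 1∕r` (Mathlib's `log_add_one_le_harmonic`, cast to `ℝ`). -/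
theorem log_succ_le_sum_Icc_inv (m : ℕ) : Real.log ((m : ℝ) + 1) ≤ ∑ r ∈ Finset.Icc 1 m, 1 / (r : ℝ) := by
  have h := log_add_one_le_harmonic m
  rw [harmonic_eq_sum_Icc, Rat.cast_sum] at h
  push_cast at h
  simpa [one_div] using h

/-- [folklore] Bernoulli: `d∕r ≤ ((r+1)∕r)^d − 1`, written as `d∕r ≤ (r+1)^d·(1∕r^d − 1∕(r+1)^d)` (`r ≥ 1`). -/
theorem bernoulli_div (d : ℕ) {r : ℕ} (hr : 1 ≤ r) :
    (d : ℝ) / r ≤ ((r : ℝ) + 1) ^ d * (1 / (r : ℝ) ^ d - 1 / ((r : ℝ) + 1) ^ d) := by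
  have hr0 : (0 : ℝ) < r := by exact_mod_cast hr
  have hr1 : (0 : ℝ) < (r : ℝ) + 1 := by positivity
  have hq : (0 : ℝ) ≤ 1 / (r : ℝ) := by positivity
  have hB : 1 + (d : ℝ) * (1 / (r : ℝ)) ≤ (1 + 1 / (r : ℝ)) ^ d := one_add_mul_le_pow (by linarith) d
  have e1 : (1 + 1 / (r : ℝ)) ^ d = ((r : ℝ) + 1) ^ d * (1 / (r : ℝ) ^ d) := by
    rw [show (1 : ℝ) + 1 / r = ((r : ℝ) + 1) / r from by rw [add_div, div_self hr0.ne'], div_pow]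
    ring
  have e2 : ((r : ℝ) + 1) ^ d * (1 / ((r : ℝ) + 1) ^ d) = 1 := by
    rw [mul_one_div, div_self (pow_ne_zero _ hr1.ne')]
  rw [mul_sub, e2, ← e1]
  have : (d : ℝ) / r = (d : ℝ) * (1 / (r : ℝ)) := by ring
  linarith

/-- [folklore] Telescoping bound for a nonnegative `φ`: `Σ_{r ∈ Ico k (k+ℓ)} (φ r − φ (r+1)) = φ k − φ (k+ℓ) ≤ φ k`. -/
theorem sum_Ico_telescope_le {φ : ℕ → ℝ} (hφ : ∀ j, 0 ≤ φ j) (k ℓ : ℕ) :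
    ∑ r ∈ Finset.Ico k (k + ℓ), (φ r - φ (r + 1)) ≤ φ k := by
  rw [Finset.sum_Ico_eq_sum_range, Nat.add_sub_cancel_left]
  have h : ∀ ℓ : ℕ, ∑ i ∈ Finset.range ℓ, (φ (k + i) - φ (k + i + 1)) = φ k - φ (k + ℓ) := by
    intro ℓ
    induction ℓ with
    | zero => simp
    | succ ℓ ih => rw [Finset.sum_range_succ, ih, ← add_assoc]; ring
  rw [h]
  linarith [hφ (k + ℓ)]

/-- [folklore] The telescoping bound over `Icc k m` (the empty sum when `m < k`). -/
theorem sum_Icc_telescope_le {φ : ℕ → ℝ} (hφ : ∀ j, 0 ≤ φ j) (k m : ℕ) :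
    ∑ r ∈ Finset.Icc k m, (φ r - φ (r + 1)) ≤ φ k := by
  by_cases hkm : k ≤ m
  · rw [← Finset.Ico_add_one_right_eq_Icc]
    have e : m + 1 = k + (m + 1 - k) := (Nat.add_sub_cancel' (by omega)).symm
    rw [e]
    exact sum_Ico_telescope_le hφ k _
  · rw [Finset.Icc_eq_empty (by omega), Finset.sum_empty]
    exact hφ k

/-- [folklore] The discrete cube `[0,m]^d ⊆ ℕ^d` has `(m+1)^d` points. -/
theorem card_W (d m : ℕ) : (Fintype.piFinset fun _ : Fin d => Finset.range (m + 1)).card = (m + 1) ^ d := by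
  rw [Fintype.card_piFinset, Finset.prod_const, Finset.card_range, Finset.card_univ, Fintype.card_fin]

/-- [folklore] Inside `[0,m]^d`, the points with `‖w‖∞ ≤ r` (`r ≤ m`) are exactly `[0,r]^d`. -/
theorem filter_W_sup_le {d r m : ℕ} (hrm : r ≤ m) :
    (Fintype.piFinset fun _ : Fin d => Finset.range (m + 1)).filter (fun w => Finset.univ.sup w ≤ r)
      = Fintype.piFinset fun _ : Fin d => Finset.range (r + 1) := by
  ext w
  simp only [Finset.mem_filter, Fintype.mem_piFinset, Finset.mem_range, Finset.sup_le_iff, Finset.mem_univ, true_implies]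
  constructor
  · rintro ⟨-, h⟩ i
    exact Nat.lt_succ_of_le (h i)
  · intro h
    exact ⟨fun i => by have := h i; omega, fun i => Nat.le_of_lt_succ (h i)⟩

/-- [folklore] **THE LAYER CAKE**: `d·Σ_{r=1}^{m} 1∕r ≤ Σ_{w ∈ [0,m]^d} max(1,‖w‖∞)^{−d}`. -/
theorem sum_W_inv_pow_ge (d m : ℕ) :
    (d : ℝ) * ∑ r ∈ Finset.Icc 1 m, 1 / (r : ℝ)
      ≤ ∑ w ∈ Fintype.piFinset (fun _ : Fin d => Finset.range (m + 1)),
          1 / (max (1 : ℝ) ((Finset.univ.sup w : ℕ) : ℝ)) ^ d := by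
  have hφ0 : ∀ j : ℕ, 0 ≤ (fun j : ℕ => 1 / (max (1 : ℝ) (j : ℝ)) ^ d) j := fun j => by
    dsimp only; positivity
  -- Step 1: term by term, Bernoulli against the cube count `#[0,r]^d = (r+1)^d`, written as a filtered sum over the big cube.
  have hstep1 : (d : ℝ) * ∑ r ∈ Finset.Icc 1 m, 1 / (r : ℝ)
      ≤ ∑ r ∈ Finset.Icc 1 m, ∑ w ∈ Fintype.piFinset (fun _ : Fin d => Finset.range (m + 1)),
          (if Finset.univ.sup w ≤ r then
            (1 / (max (1 : ℝ) (r : ℝ)) ^ d - 1 / (max (1 : ℝ) (((r + 1 : ℕ) : ℕ) : ℝ)) ^ d) else 0) := by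
    rw [Finset.mul_sum]
    refine Finset.sum_le_sum fun r hr => ?_
    have hr1 : 1 ≤ r := (Finset.mem_Icc.mp hr).1
    have hrm : r ≤ m := (Finset.mem_Icc.mp hr).2
    rw [← Finset.sum_filter, filter_W_sup_le hrm, Finset.sum_const, card_W, nsmul_eq_mul]
    push_cast
    rw [max_eq_right (show (1 : ℝ) ≤ r by exact_mod_cast hr1),
      max_eq_right (show (1 : ℝ) ≤ (r : ℝ) + 1 by linarith [(show (0 : ℝ) ≤ r from Nat.cast_nonneg r)])]
    calc (d : ℝ) * (1 / (r : ℝ)) = (d : ℝ) / r := by ring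
      _ ≤ ((r : ℝ) + 1) ^ d * (1 / (r : ℝ) ^ d - 1 / ((r : ℝ) + 1) ^ d) := bernoulli_div d hr1
  refine hstep1.trans ?_
  rw [Finset.sum_comm]
  refine Finset.sum_le_sum fun w hw => ?_
  -- Step 2: for a fixed `w`, the inner sum telescopes from `max 1 ‖w‖∞`.
  have hsm : Finset.univ.sup w ≤ m := by
    rw [Finset.sup_le_iff]
    intro i _
    have := Finset.mem_range.mp ((Fintype.mem_piFinset.mp hw) i)
    omega
  rw [← Finset.sum_filter]
  have hfl : (Finset.Icc 1 m).filter (fun r => Finset.univ.sup w ≤ r) = Finset.Icc (max 1 (Finset.univ.sup w)) m := by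
    ext r
    simp only [Finset.mem_filter, Finset.mem_Icc, max_le_iff]
    tauto
  rw [hfl]
  have key := sum_Icc_telescope_le hφ0 (max 1 (Finset.univ.sup w)) m
  refine key.trans (le_of_eq ?_)
  rcases Nat.eq_zero_or_pos (Finset.univ.sup w) with h0 | hpos
  · rw [h0]; simp
  · rw [max_eq_right (Nat.succ_le_of_lt hpos)]

end LayerCake

/-! ## §2 The orthant box of side `⌊n∕2⌋` at a site of a block stays inside the block -/

section Orthant

variable {n : ℕ}

/-- [folklore] The sign towards the roomier side is `±1`, hence nonzero. -/
theorem sgn_ne_zero (x : X d) (i : Fin d) : (if loc n x i ≤ (n / 2 : ℕ) then (1 : ℤ) else -1) ≠ 0 := by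
  split_ifs <;> norm_num

/-- [folklore] The sign towards the roomier side has absolute value `1`. -/
theorem sgn_natAbs (x : X d) (i : Fin d) : (if loc n x i ≤ (n / 2 : ℕ) then (1 : ℤ) else -1).natAbs = 1 := by
  split_ifs <;> rfl

/-- [folklore] The shifted local coordinate `loc n x i ± w i` stays in `[0, n]` when `w i ≤ ⌊n∕2⌋`. -/
theorem loc_shift_mem {x : X d} {w : Fin d → ℕ} (hw : ∀ i, w i ≤ n / 2) (i : Fin d) :
    0 ≤ loc n x i + (if loc n x i ≤ (n / 2 : ℕ) then (1 : ℤ) else -1) * (w i : ℤ) ∧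
      loc n x i + (if loc n x i ≤ (n / 2 : ℕ) then (1 : ℤ) else -1) * (w i : ℤ) ≤ n := by
  have h0 := loc_nonneg n x i
  have h1 := loc_le n x i
  have hwi : (w i : ℤ) ≤ (n / 2 : ℕ) := by exact_mod_cast hw i
  have hw0 : (0 : ℤ) ≤ w i := by positivity
  have hhalf : 2 * ((n / 2 : ℕ) : ℤ) ≤ n := by norm_cast; omega
  split_ifs with h
  · constructor <;> linarith
  · have h' := not_le.mp h
    constructor <;> linarith

/-- [folklore] The shifted local coordinate, as a natural number, is `< n+1`. -/
theorem orthant_toNat_lt {x : X d} {w : Fin d → ℕ} (hw : ∀ i, w i ≤ n / 2) (i : Fin d) :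
    (loc n x i + (if loc n x i ≤ (n / 2 : ℕ) then (1 : ℤ) else -1) * (w i : ℤ)).toNat < n + 1 := by
  have h := loc_shift_mem (x := x) hw i
  omega

/-- [folklore] `chart n y z ∈ B n y` for every local coordinate `z` (definition of `B`). -/
theorem chart_mem_B (y : X d) (z : Fin d → Fin (n + 1)) : chart n y z ∈ B n y :=
  Finset.mem_image_of_mem _ (Finset.mem_univ _)

/-- [folklore] The difference `x − chart n y z` for `x ∈ B n y` is `loc n x − z`, componentwise. -/
theorem sub_chart_apply {x y : X d} (hx : x ∈ B n y) (z : Fin d → Fin (n + 1)) (i : Fin d) :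
    (x - chart n y z) i = loc n x i - ((z i : ℕ) : ℤ) := by
  have hb : blk n x = y := mem_B.mp hx
  have e := side_mul_blk_add_loc n x i
  rw [hb] at e
  show x i - (side n * y i + ((z i : ℕ) : ℤ)) = loc n x i - ((z i : ℕ) : ℤ)
  linarith

/-- [folklore] **THE ROW LOWER BOUND**: for `x ∈ B n y`, `d·log(⌊n∕2⌋+1) ≤ Σ_{x′∈B n y} nrm(x−x′)^{−d}` — the orthant box of side `⌊n∕2⌋` at `x`
(local coordinates `loc n x ± w`, `w ∈ [0,⌊n∕2⌋]^d`) lies in the block, is injective in `w`, and `nrm(x − ·) = max(1,‖w‖∞)` on it; then §1. -/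
theorem sum_B_inv_nrm_crit_ge_row (y : X d) {x : X d} (hx : x ∈ B n y) :
    (d : ℝ) * Real.log (((n / 2 : ℕ) : ℝ) + 1) ≤ ∑ x' ∈ B n y, 1 / nrm (x - x') ^ d := by
  -- the orthant embedding `w ↦ chart n y (zOf w)`
  let sg : Fin d → ℤ := fun i => if loc n x i ≤ (n / 2 : ℕ) then (1 : ℤ) else -1
  let zOf : (Fin d → ℕ) → (Fin d → Fin (n + 1)) := fun w i =>
    ⟨(loc n x i + sg i * (w i : ℤ)).toNat % (n + 1), Nat.mod_lt _ (Nat.succ_pos n)⟩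
  let emb : (Fin d → ℕ) → X d := fun w => chart n y (zOf w)
  set W : Finset (Fin d → ℕ) := Fintype.piFinset fun _ : Fin d => Finset.range (n / 2 + 1) with hW
  have hsg0 : ∀ i, sg i ≠ 0 := fun i => sgn_ne_zero x i
  have hsg1 : ∀ i, (sg i).natAbs = 1 := fun i => sgn_natAbs x i
  have hwle : ∀ {w : Fin d → ℕ}, w ∈ W → ∀ i, w i ≤ n / 2 := fun {w} hw i => by
    have := Finset.mem_range.mp ((Fintype.mem_piFinset.mp hw) i)
    omega
  -- value of the local coordinate on `W` (no wrap-around)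
  have hzval : ∀ {w : Fin d → ℕ}, w ∈ W → ∀ i, (((zOf w i : Fin (n + 1)) : ℕ) : ℤ) = loc n x i + sg i * (w i : ℤ) := by
    intro w hw i
    have h : 0 ≤ loc n x i + sg i * (w i : ℤ) ∧ loc n x i + sg i * (w i : ℤ) ≤ n := loc_shift_mem (x := x) (hwle hw) i
    have hlt : (loc n x i + sg i * (w i : ℤ)).toNat < n + 1 := orthant_toNat_lt (x := x) (hwle hw) i
    show (((loc n x i + sg i * (w i : ℤ)).toNat % (n + 1) : ℕ) : ℤ) = _
    rw [Nat.mod_eq_of_lt hlt, Int.toNat_of_nonneg h.1]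
  -- injectivity on `W`
  have hinj : ∀ w ∈ W, ∀ w' ∈ W, emb w = emb w' → w = w' := by
    intro w hw w' hw' h
    have hz : zOf w = zOf w' := (chart_inj h).2
    funext i
    have hi : (((zOf w i : Fin (n + 1)) : ℕ) : ℤ) = (((zOf w' i : Fin (n + 1)) : ℕ) : ℤ) := by rw [hz]
    rw [hzval hw i, hzval hw' i] at hi
    have hmul : sg i * (w i : ℤ) = sg i * (w' i : ℤ) := by linarith
    exact_mod_cast mul_left_cancel₀ (hsg0 i) hmul
  -- the distance on the box
  have hnrm : ∀ {w : Fin d → ℕ}, w ∈ W → nrm (x - emb w) = max (1 : ℝ) ((Finset.univ.sup w : ℕ) : ℝ) := by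
    intro w hw
    have hcoord : ∀ i, ((x - emb w) i).natAbs = w i := by
      intro i
      have e : (x - emb w) i = loc n x i - (((zOf w i : Fin (n + 1)) : ℕ) : ℤ) := sub_chart_apply hx (zOf w) i
      rw [e, hzval hw i, show loc n x i - (loc n x i + sg i * (w i : ℤ)) = -(sg i * (w i : ℤ)) from by ring,
        Int.natAbs_neg, Int.natAbs_mul, hsg1 i, one_mul, Int.natAbs_natCast]
    have hsup : supNorm (x - emb w) = Finset.univ.sup w := by
      unfold PoissonInterior.supNorm
      exact Finset.sup_congr rfl fun i _ => hcoord i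
    show max (1 : ℝ) (supNorm (x - emb w) : ℝ) = _
    rw [hsup]
  -- compare the row with the sum over the embedded box
  have hsub : W.image emb ⊆ B n y := by
    intro x' hx'
    obtain ⟨w, -, rfl⟩ := Finset.mem_image.mp hx'
    exact chart_mem_B y _
  have hle : ∑ w ∈ W, 1 / (max (1 : ℝ) ((Finset.univ.sup w : ℕ) : ℝ)) ^ d ≤ ∑ x' ∈ B n y, 1 / nrm (x - x') ^ d := by
    have e1 : ∑ w ∈ W, 1 / (max (1 : ℝ) ((Finset.univ.sup w : ℕ) : ℝ)) ^ d = ∑ w ∈ W, 1 / nrm (x - emb w) ^ d :=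
      Finset.sum_congr rfl fun w hw => by rw [hnrm hw]
    have e2 : ∑ x' ∈ W.image emb, 1 / nrm (x - x') ^ d = ∑ w ∈ W, 1 / nrm (x - emb w) ^ d := Finset.sum_image hinj
    rw [e1, ← e2]
    exact Finset.sum_le_sum_of_subset_of_nonneg hsub fun x' _ _ => by have := nrm_pos (x - x'); positivity
  refine le_trans ?_ ((sum_W_inv_pow_ge d (n / 2)).trans hle)
  exact mul_le_mul_of_nonneg_left (log_succ_le_sum_Icc_inv (n / 2)) (Nat.cast_nonneg d)

end Orthant

/-! ## §3 The same-block critical count: two-sided, and no linear constant -/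

section SameBlock

/-- [folklore] `log(n+1) − log 2 ≤ log(⌊n∕2⌋ + 1)`. -/
theorem log_succ_sub_log_two_le (n : ℕ) : Real.log ((n : ℝ) + 1) - Real.log 2 ≤ Real.log (((n / 2 : ℕ) : ℝ) + 1) := by
  have h2 : ((n : ℝ) + 1) / 2 ≤ ((n / 2 : ℕ) : ℝ) + 1 := by
    have : (n : ℝ) ≤ 2 * ((n / 2 : ℕ) : ℝ) + 1 := by exact_mod_cast (by omega : n ≤ 2 * (n / 2) + 1)
    linarith
  have hpos : (0 : ℝ) < ((n : ℝ) + 1) / 2 := by positivity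
  rw [← Real.log_div (by positivity) (by norm_num)]
  exact Real.log_le_log hpos h2

/-- [folklore] **THE SAME-BLOCK CRITICAL COUNT IS AT LEAST `d·(n+1)^d·(log(n+1) − log 2)`** (any `d`, any block side `n+1`, any block `y`). -/
theorem sum_B_sum_B_inv_nrm_crit_ge (n : ℕ) (y : X d) :
    (d : ℝ) * ((n : ℝ) + 1) ^ d * (Real.log ((n : ℝ) + 1) - Real.log 2)
      ≤ ∑ x ∈ B n y, ∑ x' ∈ B n y, 1 / nrm (x - x') ^ d := by
  have hrow : ∀ x ∈ B n y, (d : ℝ) * Real.log (((n / 2 : ℕ) : ℝ) + 1) ≤ ∑ x' ∈ B n y, 1 / nrm (x - x') ^ d :=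
    fun x hx => sum_B_inv_nrm_crit_ge_row y hx
  have hsum := Finset.sum_le_sum hrow
  rw [Finset.sum_const, nsmul_eq_mul, card_B n y] at hsum
  have hpos : (0 : ℝ) ≤ (d : ℝ) * ((n : ℝ) + 1) ^ d := by positivity
  calc (d : ℝ) * ((n : ℝ) + 1) ^ d * (Real.log ((n : ℝ) + 1) - Real.log 2)
      ≤ (d : ℝ) * ((n : ℝ) + 1) ^ d * Real.log (((n / 2 : ℕ) : ℝ) + 1) :=
        mul_le_mul_of_nonneg_left (log_succ_sub_log_two_le n) hpos
    _ = ((n : ℝ) + 1) ^ d * ((d : ℝ) * Real.log (((n / 2 : ℕ) : ℝ) + 1)) := by ring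
    _ ≤ _ := hsum

/-- [folklore] The upper companion (b2b leaf-04's critical window `LatticeHLSRadial.sum_inv_nrm_pow_crit_le` BY NAME, row by row):
`Σ_{x∈B n y}Σ_{x′∈B n y} nrm(x−x′)^{−d} ≤ (n+1)^d·(1 + 2d·3^{d−1}·(1 + log n))`. -/
theorem sum_B_sum_B_inv_nrm_crit_le_same (hd : 0 < d) (n : ℕ) (y : X d) :
    ∑ x ∈ B n y, ∑ x' ∈ B n y, 1 / nrm (x - x') ^ d
      ≤ ((n : ℝ) + 1) ^ d * (1 + 2 * d * 3 ^ (d - 1) * (1 + Real.log n)) := by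
  have hrow : ∀ x ∈ B n y, ∑ x' ∈ B n y, 1 / nrm (x - x') ^ d ≤ 1 + 2 * d * 3 ^ (d - 1) * (1 + Real.log n) := by
    intro x hx
    have h := sum_inv_nrm_pow_crit_le hd (B n y) x (R := n) fun x' hx' => supNorm_sub_le_of_mem_B hx' hx
    simpa only [nrm_sub_comm] using h
  refine (Finset.sum_le_sum hrow).trans (le_of_eq ?_)
  rw [Finset.sum_const, nsmul_eq_mul, card_B]

/-- [folklore] **NO LINEAR CONSTANT**: there is no `C` with `Σ_{x,x′∈B n y} nrm(x−x′)^{−d} ≤ C·(n+1)^d` for all block sides and blocks (`d ≥ 1`). -/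
theorem not_exists_sameBlock_crit_le_linear (hd : 0 < d) :
    ¬ ∃ C : ℝ, ∀ (n : ℕ) (y : X d), ∑ x ∈ B n y, ∑ x' ∈ B n y, 1 / nrm (x - x') ^ d ≤ C * ((n : ℝ) + 1) ^ d := by
  rintro ⟨C, hC⟩
  have hd0 : (0 : ℝ) < d := by exact_mod_cast hd
  -- choose `n` with `log(n+1) > C∕d + log 2`
  obtain ⟨n, hn⟩ := exists_nat_gt (Real.exp (C / d + Real.log 2))
  have hn1 : Real.exp (C / d + Real.log 2) < (n : ℝ) + 1 := by linarith
  have hlog : C / d + Real.log 2 < Real.log ((n : ℝ) + 1) := (Real.lt_log_iff_exp_lt (by positivity)).mpr hn1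
  have hgap : C < (d : ℝ) * (Real.log ((n : ℝ) + 1) - Real.log 2) := by
    have e : C = (d : ℝ) * (C / d) := by field_simp
    rw [e]
    exact mul_lt_mul_of_pos_left (by linarith) hd0
  have hpow : (0 : ℝ) < ((n : ℝ) + 1) ^ d := by positivity
  have h12 : (d : ℝ) * ((n : ℝ) + 1) ^ d * (Real.log ((n : ℝ) + 1) - Real.log 2) ≤ C * ((n : ℝ) + 1) ^ d :=
    (sum_B_sum_B_inv_nrm_crit_ge n (0 : X d)).trans (hC n 0)
  have h3 : ((d : ℝ) * (Real.log ((n : ℝ) + 1) - Real.log 2)) * ((n : ℝ) + 1) ^ d ≤ C * ((n : ℝ) + 1) ^ d := by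
    calc ((d : ℝ) * (Real.log ((n : ℝ) + 1) - Real.log 2)) * ((n : ℝ) + 1) ^ d
        = (d : ℝ) * ((n : ℝ) + 1) ^ d * (Real.log ((n : ℝ) + 1) - Real.log 2) := by ring
      _ ≤ _ := h12
  have h4 : (d : ℝ) * (Real.log ((n : ℝ) + 1) - Real.log 2) ≤ C := le_of_mul_le_mul_right h3 hpow
  linarith

end SameBlock

/-! ## §4 The `d = 4` readings -/

section Four

/-- [folklore] `d = 4`: `4·(n+1)⁴·(log(n+1) − log 2) ≤ Σ_{x,x′∈B n y} nrm(x−x′)^{−4}`. -/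
theorem four_sameBlock_crit_ge (n : ℕ) (y : X 4) :
    4 * ((n : ℝ) + 1) ^ 4 * (Real.log ((n : ℝ) + 1) - Real.log 2) ≤ ∑ x ∈ B n y, ∑ x' ∈ B n y, 1 / nrm (x - x') ^ 4 := by
  have h := sum_B_sum_B_inv_nrm_crit_ge (d := 4) n y
  exact_mod_cast h

/-- [folklore] `d = 4` in the road's spelling (blocks `B (n−1) y` of side `n`, `[NeZero n]`): `4·n⁴·(log n − log 2) ≤ Σ_{x,x′∈B (n−1) y} nrm(x−x′)^{−4}`. -/
theorem four_sameBlock_crit_ge_pred (n : ℕ) [NeZero n] (y : X 4) :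
    4 * (n : ℝ) ^ 4 * (Real.log n - Real.log 2) ≤ ∑ x ∈ B (n - 1) y, ∑ x' ∈ B (n - 1) y, 1 / nrm (x - x') ^ 4 := by
  have h := four_sameBlock_crit_ge (n - 1) y
  rwa [cast_pred_add_one n] at h

/-- [folklore] `d = 4`: no constant `C` with `Σ_{x,x′∈B n y} nrm(x−x′)^{−4} ≤ C·(n+1)⁴` for all `n`, `y`. -/
theorem not_exists_sameBlock_crit_le_linear_four :
    ¬ ∃ C : ℝ, ∀ (n : ℕ) (y : X 4), ∑ x ∈ B n y, ∑ x' ∈ B n y, 1 / nrm (x - x') ^ 4 ≤ C * ((n : ℝ) + 1) ^ 4 :=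
  not_exists_sameBlock_crit_le_linear (d := 4) (by norm_num)

end Four

end

end Summit.QuantumFields.BalabanUV.Gaps.BlockPairCriticalSameBlockLog
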